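import Summits.AtomisticToContinuum.FouriersLaw.Theorems.VanishingNoiseTransferNoisyFourierFlipNessExistsUnique
import Summits.AtomisticToContinuum.FouriersLaw.Theorems.EmbeddedDrudeMourreNessUnique
import Literature.MathematicalPhysics.KineticTheory.LangevinChainNESSHolds
import Literature.MathematicalPhysics.KineticTheory.VelocityFlipNoise

/-!
# Stub `stub_flipSteadyStateWellPosed` of crux `NoiseLocality` (line `fekete-transposed-uniformity`)

Crux `VanishingNoiseTransfer.NoiseLocality` (stmt-AtomisticToContinuum-11975), line
`fekete-transposed-uniformity`, registered stub 1: for the pinned anharmonic chain `pinnedChain ω₂ lam β γ`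
(`ω₂, lam, β, γ > 0`), every length `N`, every flip rate `ε ∈ [0,1]` and all bath temperatures
`T_L, T_R > 0`, the weak steady state of `L + εS` (`IsFlipSteadyState`: probability measure annihilating
`L + εS` on `C_c^∞`, bond currents integrable) EXISTS and is UNIQUE.

* `ε > 0`: the landed clause (i) of `NoisyFourier`, `flipNessExistsUnique` (`∃!`, unpacked).
* `ε = 0`: `IsFlipSteadyState N T_L T_R 0 μ ↔ IsSteadyState N T_L T_R μ` (`isFlipSteadyState_zero_iff`);
  existence is `pinnedChain_exists_isSteadyState` (Cuneo–Eckmann–Hairer–Rey-Bellet 2018, Thm 2.13, in the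
  tree) and uniqueness is the landed `NessUnique` (`nessUnique_proof`, stmt-AtomisticToContinuum-0741).

No definitions.
-/

noncomputable section

namespace Summit.AtomisticToContinuum.FouriersLaw.Theorems.NoiseLocality

open MeasureTheory
open Literature.MathematicalPhysics.KineticTheory.HeatConduction

/-- **Stub 1 of line `fekete-transposed-uniformity` (fixed-`N` well-posedness on the closed noise
interval).** For `pinnedChain ω₂ lam β γ` (all parameters `> 0`), every `N`, every flip rate `ε ∈ [0,1]`
and all `T_L, T_R > 0`, the weak steady state of `L + εS` exists and is unique. `ε > 0`:
`flipNessExistsUnique` (clause (i) of `NoisyFourier`); `ε = 0`: `pinnedChain_exists_isSteadyState` and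
`nessUnique_proof` through `isFlipSteadyState_zero_iff`. [cite: BernardinOlla2011, Prop 1] -/
theorem stub_flipSteadyStateWellPosed :
    ∀ ω₂ lam β γ : ℝ, 0 < ω₂ → 0 < lam → 0 < β → 0 < γ →
    ∀ (N : ℕ) (ε : ℝ), 0 ≤ ε → ε ≤ 1 → ∀ T_L T_R : ℝ, 0 < T_L → 0 < T_R →
      ∃ μ : MeasureTheory.Measure (Literature.MathematicalPhysics.KineticTheory.HeatConduction.PhaseSpace N),
        (Literature.MathematicalPhysics.KineticTheory.HeatConduction.pinnedChain ω₂ lam β γ).IsFlipSteadyState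
            N T_L T_R ε μ ∧
          ∀ ν : MeasureTheory.Measure (Literature.MathematicalPhysics.KineticTheory.HeatConduction.PhaseSpace N),
            (Literature.MathematicalPhysics.KineticTheory.HeatConduction.pinnedChain ω₂ lam β γ).IsFlipSteadyState
              N T_L T_R ε ν → ν = μ := by
  intro ω₂ lam β γ hω hl hβ hγ N ε hε0 _hε1 T_L T_R hL hR
  rcases hε0.lt_or_eq with hε | hε
  · -- positive rate: clause (i) of `NoisyFourier` (landed `flipNessExistsUnique`), `∃!` unpacked
    obtain ⟨μ, hμ, huniq⟩ :=
      Summit.AtomisticToContinuum.FouriersLaw.Cruxes.NoisyFourier.SectorDirichletGluing.flipNessExistsUnique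
        ω₂ lam β γ hω hl hβ hγ ε hε N T_L T_R hL hR
    exact ⟨μ, hμ, huniq⟩
  · -- rate `0`: the deterministic chain
    subst hε
    obtain ⟨μ, hμ⟩ := pinnedChain_exists_isSteadyState hω hl hβ hγ N hL hR
    refine ⟨μ, ((pinnedChain ω₂ lam β γ).isFlipSteadyState_zero_iff N T_L T_R μ).2 hμ, fun ν hν => ?_⟩
    exact Summit.AtomisticToContinuum.FouriersLaw.Theorems.nessUnique_proof ω₂ lam β γ hω hl hβ hγ N T_L T_R
      hL hR ν μ (((pinnedChain ω₂ lam β γ).isFlipSteadyState_zero_iff N T_L T_R ν).1 hν) hμ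

end Summit.AtomisticToContinuum.FouriersLaw.Theorems.NoiseLocality

end
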